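import Literature.Combinatorics.Optimization.CompletelyPsdRank
import Literature.Combinatorics.Optimization.CpsdSupportBoundLeastEigenvalue
import Mathlib.RingTheory.RootsOfUnity.Complex
import HarnessLib

/-!
# Gram–Lorentz matrices: (non-)convexity of `GL^n` and the `DNN ∖ CP` criterion (PSVW §4.2–§4.3)

Source: A. Prakash, J. Sikora, A. Varvitsiotis, Z. Wei, *Completely positive semidefinite rank*,
Math. Program. 171 (2018) 397–431 = arXiv:1604.07199 [PrakashEtAl2017], §4.2 "Gram-Lorentz matrices"
and §4.3 "Matrices in `CS_+ ∖ CP`" (held text `paper:arxiv-1604.07199`, chunks p13–p15).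

`CompletelyPsdRank.lean` (same directory) has the vocabulary (`IsGramLorentz` = Definitions 2–3,
`IsCp`, `IsDnn`, `IsCpsd`), Theorem 6/6′, Theorem 7 and Corollary 1 (the explicit family
`cyclicLorentzGram`, proved not completely positive by a direct specialisation of the parity argument).
Its module docstring lists as NOT typed the stand-alone statements of §4.2–§4.3: Lemma 6, Lemma 8 and
Theorem 8 (the general sufficient condition for `DNN ∖ CP`). They are typed and PROVED here:

* **Lemma 6** (p13–p14): "The set `GL^n` is convex if and only if `n ≤ 2`." With its two printed
  ingredients: `GL² = DNN²` (every `2 × 2` doubly nonnegative matrix is the Gram matrix of two vectors of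
  `L_3`, the printed vectors `v₁ = √(a/2)(1,1,0)`, `v₂ = √(c/2)(1, d, √(1−d²))`, `d = (2b − √(ac))/√(ac)`),
  and `2I_n ∉ GL^n` for `n ≥ 3` (Cauchy–Schwarz forces `t_i = ‖u_i‖ = 1` and `u_i = −u_j`), while
  `2I_n ∈ conv(GL^n)`: `isGramLorentz_iff_isDnn_two`, `isGramLorentz_iff_isDnn_of_le_two`,
  `two_smul_one_not_isGramLorentz`, `convex_setOf_isGramLorentz_iff` (= Lemma 6).
* **Lemma 8** (p14): Gram-isometric families inherit common linear relations, with the same norm of the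
  common value: `PrakashEtAl2017_lemma8` (for arbitrary real inner product spaces).
* **Theorem 8** (p14): the sufficient condition (i)–(iv) on a family `F = ∪_i {p_i, p'_i}` for
  `Gram(F) ∈ DNN ∖ CP`: `PrakashEtAl2017_thm8`. Typed for a family `v : κ → ℝ^d` containing the pairs
  through index maps `f, g : ι → κ` (`p_i = v (f i)`, `p'_i = v (g i)`); the printed `F` is the case
  "`v` injective with range `∪_i {p_i, p'_i}`", and the proof never uses that `F` has no further
  members, so the typed form is the printed one plus harmless generality. PROVED by the printed parity
  argument (Lemma 8 gives `a` with `(a_i + a'_i)/2 = a`, `Σ_{j∈J} a_j = |J| a`, `‖a‖ = ‖c‖`; `b_i = a_i − a`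
  has `|b_i(k)| ≤ a(k)` and `‖b_i‖ = ‖a‖`, so `b_i(k) = ±a(k)`; summing over the odd set `J` at a
  coordinate with `a(k) ≠ 0` is the contradiction).
* **Corollary 1 re-derived from Theorem 8** (p14–p15: "Since `ℓ` is odd, it follows from Theorem 8 that
  `X := Gram({p_k})` is not completely positive"): the vectors `p_k = (1, cos(2πk/n), sin(2πk/n))`,
  `n = 2ℓ`, `ℓ ≥ 3` odd, satisfy (i)–(iv) with `p'_k = p_{k+ℓ}`, `c = (1,0,0)`, `J = {0, 2, …, 2ℓ−2}`:
  `PrakashEtAl2017_cor1_of_thm8` (the tree's `PrakashEtAl2017_cor1_holds` proves the same by hand).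

Also: Gram matrices of real vectors are positive semidefinite (`posSemidef_of_inner`, the `DNN` half of
Theorem 8).

* **Lemma 7** (p14, appended): "Any `X ∈ GL^n` has a `GL`-factorization using vectors in
  `L_{rank(X)+2}`" — the stand-alone statement `PrakashEtAl2017_lemma7` (Lorentz vectors `(c_i, y_i)`
  with `y_i ∈ ℝ^{rank X + 1}`), PROVED by the printed route: `X = ttᵀ + U`, `U = Gram(u_i) ⪰ 0` of rank
  `≤ rank X + 1`, Gram vectors of `U` in `ℝ^{rank U}` (`exists_gram_vectors_fin_rank`,
  `CpsdSupportBoundLeastEigenvalue.lean`) padded by zeros; `isGramLorentz_iff_rank`. (Inside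
  `PrakashEtAl2017_thm7_holds` the same compression is fused with Theorem 6′; this is the lemma itself.)
-/

noncomputable section

open Matrix Finset
open scoped RealInnerProductSpace

namespace Literature.Combinatorics.Optimization

/-! ### Gram matrices of families of real vectors -/

section Gram

variable {E : Type*} [NormedAddCommGroup E] [InnerProductSpace ℝ E]

/-- `⟨Σ α_i p_i, Σ β_j p_j⟩ = Σ_{i,j} α_i β_j ⟨p_i, p_j⟩`. [folklore] -/
private theorem inner_sum_smul_sum_smul {ι : Type*} [Fintype ι] (p : ι → E) (α β : ι → ℝ) :
    ⟪∑ i, α i • p i, ∑ j, β j • p j⟫ = ∑ i, ∑ j, α i * β j * ⟪p i, p j⟫ := by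
  rw [sum_inner]
  refine Finset.sum_congr rfl fun i _ => ?_
  rw [inner_sum]
  refine Finset.sum_congr rfl fun j _ => ?_
  rw [real_inner_smul_left, real_inner_smul_right]
  ring

/-- A Gram matrix `(⟨v_a, v_b⟩)_{a,b}` of real vectors is positive semidefinite:
`wᵀ G w = ‖Σ w_a v_a‖² ≥ 0` (the `DNN` half of Theorem 8: "By (iv) we have `Gram(F) ∈ DNN`").
[cite: PrakashEtAl2017, Thm. 8 proof (p14)] -/
theorem posSemidef_of_inner {κ : Type*} [Fintype κ] (v : κ → E) :
    (Matrix.of fun a b => ⟪v a, v b⟫).PosSemidef := by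
  rw [Matrix.posSemidef_iff_dotProduct_mulVec]
  refine ⟨?_, fun w => ?_⟩
  · ext a b
    rw [conjTranspose_apply, star_trivial, of_apply, of_apply, real_inner_comm]
  · have h : star w ⬝ᵥ ((Matrix.of fun a b => ⟪v a, v b⟫) *ᵥ w) = ⟪∑ a, w a • v a, ∑ b, w b • v b⟫ := by
      rw [inner_sum_smul_sum_smul, star_trivial]
      simp only [dotProduct, mulVec, of_apply, Finset.mul_sum]
      exact Finset.sum_congr rfl fun a _ => Finset.sum_congr rfl fun b _ => by ring
    rw [h]
    exact real_inner_self_nonneg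

/-- `Σ_b (if b = k then 1 else 0) • w_b = w_k`. [folklore] -/
private theorem sum_ite_eq_smul {κ : Type*} [Fintype κ] [DecidableEq κ] {M : Type*} [AddCommMonoid M]
    [Module ℝ M] (w : κ → M) (k : κ) : ∑ b, (if b = k then (1 : ℝ) else 0) • w b = w k := by
  rw [Finset.sum_eq_single k]
  · rw [if_pos rfl, one_smul]
  · intro b _ hb
    rw [if_neg hb, zero_smul]
  · intro h
    exact absurd (Finset.mem_univ k) h

end Gram

/-! ### Lemma 8: Gram-isometric families inherit common linear relations -/

/-- **PSVW Lemma 8** (p14, verbatim): "Consider vectors `{p_i}_{i=1}^n ⊆ ℝ^d` and scalars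
`{λ_i^j : i ∈ [n], j ∈ [m]}` such that `c := Σ_i λ_i^j p_i` for all `j ∈ [m]`. Consider vectors
`{q_i}_{i=1}^n ⊆ ℝ^{d'}` satisfying `⟨p_i, p_j⟩ = ⟨q_i, q_j⟩` for all `i, j ∈ [n]`. Then there exists
`c' ∈ ℝ^{d'}` such that `‖c‖ = ‖c'‖` and moreover `c' = Σ_i λ_i^j q_i` for all `j ∈ [m]`." (Proof: for
`j ≠ j'`, `‖c'_j − c'_{j'}‖² = 0`; `‖c'‖² = ‖c‖²`.) Typed for any real inner product spaces in place of
`ℝ^d`, `ℝ^{d'}`, the relations indexed by a type `κ` with a distinguished `j₀` (`m ≥ 1`, implicit in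
print). [cite: PrakashEtAl2017, Lemma 8 (p14)] -/
theorem PrakashEtAl2017_lemma8 {ι κ : Type*} [Fintype ι] {E E' : Type*} [NormedAddCommGroup E]
    [InnerProductSpace ℝ E] [NormedAddCommGroup E'] [InnerProductSpace ℝ E']
    (p : ι → E) (q : ι → E') (hpq : ∀ i j, ⟪p i, p j⟫ = ⟪q i, q j⟫)
    (lam : κ → ι → ℝ) (c : E) (hc : ∀ j, ∑ i, lam j i • p i = c) (j₀ : κ) :
    ∃ c' : E', ‖c'‖ = ‖c‖ ∧ ∀ j, ∑ i, lam j i • q i = c' := by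
  have key : ∀ α β : ι → ℝ, ⟪∑ i, α i • q i, ∑ i, β i • q i⟫ = ⟪∑ i, α i • p i, ∑ i, β i • p i⟫ := by
    intro α β
    rw [inner_sum_smul_sum_smul, inner_sum_smul_sum_smul]
    simp only [hpq]
  refine ⟨∑ i, lam j₀ i • q i, ?_, fun j => ?_⟩
  · rw [norm_eq_sqrt_real_inner, norm_eq_sqrt_real_inner (F := E), key, hc]
  · have h : ∑ i, lam j i • q i - ∑ i, lam j₀ i • q i = ∑ i, (lam j i - lam j₀ i) • q i := by
      rw [← Finset.sum_sub_distrib]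
      simp only [sub_smul]
    have h' : ∑ i, (lam j i - lam j₀ i) • p i = 0 := by
      simp only [sub_smul, Finset.sum_sub_distrib, hc, sub_self]
    rw [← sub_eq_zero, h, ← inner_self_eq_zero (𝕜 := ℝ), key, h', inner_zero_left]

/-! ### Theorem 8: a sufficient condition for `Gram(F) ∈ DNN ∖ CP` -/

/-- **PSVW Theorem 8** (p14, verbatim): "Consider vectors `F := ∪_{i∈I} {p_i, p'_i}` with the following
properties: (i) There exists a nonzero vector `c` such that `(p_i + p'_i)/2 = c`, for all `i ∈ I`;
(ii) For all `i ∈ I` we have `⟨p_i, p'_i⟩ = 0`; (iii) There exists `J ⊆ I` that has odd cardinality and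
`Σ_{j∈J} p_j = c·|J|`; (iv) The pairwise inner products of all vectors in `F` are nonnegative. Then we
have that `Gram(F) ∈ DNN ∖ CP`." Typed for a family `v : κ → ℝ^d` (the vectors of `F`) together with
index maps `f, g : ι → κ` locating the pairs, `p_i = v (f i)`, `p'_i = v (g i)` (so repeated vectors
and members of `F` outside the pairs are allowed — the printed case is `v` injective onto
`∪_i {p_i, p'_i}`; the proof does not use more), (i) as `p_i + p'_i = 2c`, (iii) for a `Finset J` of
`ι`; `Gram(F) = (⟨v_a, v_b⟩)_{a,b∈κ}`, `DNN`/`CP` = `IsDnn`/`IsCp`. PROVED by the printed argument: a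
nonnegative Gram factorization `{a_f}` inherits (Lemma 8) a vector `a`, `‖a‖ = ‖c‖ ≠ 0`, with
`(a_i + a'_i)/2 = a` and `Σ_{j∈J} a_j = |J| a`; `b_i := a_i − a = a − a'_i` has `‖b_i‖² =
⟨a_i − a, a − a'_i⟩ = ‖a‖²` (by (ii)) and `|b_i(k)| ≤ a(k)` (nonnegativity of `a ± b_i`), hence
`b_i(k) = ±a(k)`; at a coordinate with `a(k) ≠ 0`, `Σ_{j∈J} b_j(k) = 0` is a vanishing sum of an odd
number of `±a(k)` — impossible. [cite: PrakashEtAl2017, Thm. 8 (p14), Lemma 8 (p14)] -/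
theorem PrakashEtAl2017_thm8 {κ ι : Type*} [Fintype κ] [DecidableEq κ] [Fintype ι] {d : ℕ}
    (v : κ → EuclideanSpace ℝ (Fin d)) (f g : ι → κ) (c : EuclideanSpace ℝ (Fin d)) (hc : c ≠ 0)
    (h1 : ∀ i, v (f i) + v (g i) = (2 : ℝ) • c) (h2 : ∀ i, ⟪v (f i), v (g i)⟫ = 0)
    (J : Finset ι) (hJ : Odd J.card) (h3 : ∑ j ∈ J, v (f j) = (J.card : ℝ) • c)
    (h4 : ∀ a b, 0 ≤ ⟪v a, v b⟫) :
    IsDnn (Matrix.of fun a b => ⟪v a, v b⟫) ∧ ¬ IsCp (Matrix.of fun a b => ⟪v a, v b⟫) := by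
  classical
  refine ⟨⟨posSemidef_of_inner v, fun a b => h4 a b⟩, ?_⟩
  rintro ⟨D, a, ha, hX⟩
  simp only [of_apply] at hX
  -- the Gram vectors `q_k = a_k ∈ ℝ^D_+` of the cp factorization
  set q : κ → EuclideanSpace ℝ (Fin D) := fun k => WithLp.toLp 2 (a k) with hq
  have hvq : ∀ k k', ⟪v k, v k'⟫ = ⟪q k, q k'⟫ := by
    intro k k'
    rw [hX, hq, EuclideanSpace.inner_toLp_toLp, star_trivial]
    simp only [dotProduct]
    exact Finset.sum_congr rfl fun l _ => mul_comm _ _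
  have hJ0 : J.card ≠ 0 := fun h => by
    rw [h] at hJ
    exact (Nat.not_odd_iff_even.mpr (by decide)) hJ
  have hJR : (J.card : ℝ) ≠ 0 := by exact_mod_cast hJ0
  -- the common linear relations: `c = ½ p_i + ½ p'_i` (`i ∈ I`) and `c = |J|⁻¹ Σ_{j∈J} p_j`
  let lam : Option ι → κ → ℝ := fun o k =>
    match o with
    | none => (J.card : ℝ)⁻¹ * ∑ j ∈ J, (if k = f j then 1 else 0)
    | some i => (1 / 2 : ℝ) * ((if k = f i then 1 else 0) + (if k = g i then 1 else 0))
  have hsome : ∀ {M : Type} [AddCommGroup M] [Module ℝ M] (w : κ → M) (i : ι),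
      ∑ k, lam (some i) k • w k = (1 / 2 : ℝ) • (w (f i) + w (g i)) := by
    intro M _ _ w i
    simp only [lam, mul_smul, ← Finset.smul_sum, add_smul, Finset.sum_add_distrib, sum_ite_eq_smul]
  have hnone : ∀ {M : Type} [AddCommGroup M] [Module ℝ M] (w : κ → M),
      ∑ k, lam none k • w k = (J.card : ℝ)⁻¹ • ∑ j ∈ J, w (f j) := by
    intro M _ _ w
    simp only [lam, mul_smul, ← Finset.smul_sum, Finset.sum_smul]
    rw [Finset.sum_comm]
    simp only [sum_ite_eq_smul]
  have hrel : ∀ o, ∑ k, lam o k • v k = c := by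
    rintro (_ | i)
    · rw [hnone, h3, smul_smul, inv_mul_cancel₀ hJR, one_smul]
    · rw [hsome, h1, smul_smul]
      norm_num
  obtain ⟨a', ha'c, ha'⟩ := PrakashEtAl2017_lemma8 v q hvq lam c hrel none
  have hE1 : ∀ i, q (f i) + q (g i) = (2 : ℝ) • a' := by
    intro i
    have h := ha' (some i)
    rw [hsome] at h
    rw [← h, smul_smul]
    norm_num
  have hE3 : ∑ j ∈ J, q (f j) = (J.card : ℝ) • a' := by
    have h := ha' none
    rw [hnone] at h
    rw [← h, smul_smul, mul_inv_cancel₀ hJR, one_smul]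
  -- coordinates: `α = a'`, entries `a_{f i}(l) + a_{g i}(l) = 2 α(l)`, `Σ_l a_{f i}(l) a_{g i}(l) = 0`
  set α : Fin D → ℝ := WithLp.ofLp a' with hα
  have hE1' : ∀ i l, a (f i) l + a (g i) l = 2 * α l := by
    intro i l
    have h := congrArg (fun x : EuclideanSpace ℝ (Fin D) => (WithLp.ofLp x : Fin D → ℝ) l) (hE1 i)
    simpa [hq, hα] using h
  have hE2' : ∀ i, ∑ l, a (f i) l * a (g i) l = 0 := by
    intro i
    rw [← hX]
    exact h2 i
  have hE3' : ∀ l, ∑ j ∈ J, a (f j) l = J.card * α l := by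
    intro l
    have h := congrArg (fun x : EuclideanSpace ℝ (Fin D) => (WithLp.ofLp x : Fin D → ℝ) l) hE3
    simpa [hq, hα, WithLp.ofLp_sum] using h
  -- `‖b_i‖² = ‖a‖²` in coordinates: `Σ_l (a_{f i}(l) − α(l))² = Σ_l α(l)²`
  have hE4 : ∀ i, ∑ l, (a (f i) l - α l) ^ 2 = ∑ l, α l ^ 2 := by
    intro i
    have h : ∀ l, (a (f i) l - α l) ^ 2 = α l ^ 2 + (a (f i) l * a (f i) l - 2 * α l * a (f i) l) := by
      intro l
      ring
    have h' : ∑ l, (a (f i) l * a (f i) l - 2 * α l * a (f i) l) = 0 := by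
      have e : ∀ l, a (f i) l * a (f i) l - 2 * α l * a (f i) l = -(a (f i) l * a (g i) l) := by
        intro l
        linear_combination (a (f i) l) * hE1' i l
      simp only [e, Finset.sum_neg_distrib, hE2' i, neg_zero]
    simp only [h, Finset.sum_add_distrib, h', add_zero]
  -- termwise `(a_{f i}(l) − α(l))² ≤ α(l)²` (`0 ≤ a_{f i}(l) ≤ 2α(l)`), hence equality termwise
  have hle : ∀ i l, (a (f i) l - α l) ^ 2 ≤ α l ^ 2 := by
    intro i l
    have h0 := ha (f i) l
    have h0' := ha (g i) l
    have h := hE1' i l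
    nlinarith
  have heq : ∀ i l, (a (f i) l - α l) ^ 2 = α l ^ 2 := by
    intro i
    have h := (Finset.sum_eq_sum_iff_of_le (s := Finset.univ) fun l _ => hle i l).mp (hE4 i)
    exact fun l => h l (Finset.mem_univ l)
  -- so `a_{f i}(l) ∈ {0, 2α(l)}`
  have hcases : ∀ i l, a (f i) l = 0 ∨ a (f i) l = 2 * α l := by
    intro i l
    have h := heq i l
    have h' : a (f i) l * (a (f i) l - 2 * α l) = 0 := by nlinarith [h]
    rcases mul_eq_zero.mp h' with h'' | h''
    · exact Or.inl h''
    · exact Or.inr (by linarith)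
  -- a coordinate with `α(l) ≠ 0` (`‖a'‖ = ‖c‖ ≠ 0`)
  have ha'0 : a' ≠ 0 := by
    intro h
    rw [h, norm_zero] at ha'c
    exact hc (norm_eq_zero.mp ha'c.symm)
  obtain ⟨l, hl⟩ : ∃ l, α l ≠ 0 := by
    by_contra h
    push Not at h
    apply ha'0
    rw [← WithLp.ofLp_eq_zero (p := 2)]
    exact funext h
  -- parity at the coordinate `l`
  set P : Finset ι := J.filter fun j => a (f j) l = 2 * α l with hP
  set N : Finset ι := J.filter fun j => a (f j) l = 0 with hN
  have hPN : Disjoint P N := by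
    rw [Finset.disjoint_filter]
    intro j _ h h'
    rw [h'] at h
    exact hl (by linarith)
  have hPUN : P ∪ N = J := by
    ext j
    simp only [hP, hN, Finset.mem_union, Finset.mem_filter]
    constructor
    · rintro (⟨h, _⟩ | ⟨h, _⟩) <;> exact h
    · intro hj
      rcases hcases j l with h | h
      · exact Or.inr ⟨hj, h⟩
      · exact Or.inl ⟨hj, h⟩
  have hsum : ∑ j ∈ J, a (f j) l = P.card * (2 * α l) := by
    rw [← hPUN, Finset.sum_union hPN]
    have hPs : ∑ j ∈ P, a (f j) l = P.card * (2 * α l) := by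
      rw [Finset.sum_congr rfl fun j hj => (Finset.mem_filter.mp hj).2, Finset.sum_const, nsmul_eq_mul]
    have hNs : ∑ j ∈ N, a (f j) l = 0 :=
      Finset.sum_eq_zero fun j hj => (Finset.mem_filter.mp hj).2
    rw [hPs, hNs, add_zero]
  have hcard : (J.card : ℝ) = 2 * P.card := by
    have h := hE3' l
    rw [hsum] at h
    have : (J.card : ℝ) * α l = (2 * P.card) * α l := by linarith
    exact mul_right_cancel₀ hl this
  have hcardN : J.card = 2 * P.card := by exact_mod_cast hcard
  exact (Nat.not_even_iff_odd.mpr hJ) ⟨P.card, by omega⟩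

/-! ### Corollary 1 re-derived from Theorem 8 -/

section Cor1

open Real

/-- `Σ_{j<ℓ} cos(2πj/ℓ) = 0` and `Σ_{j<ℓ} sin(2πj/ℓ) = 0` for `ℓ ≥ 2` (the `ℓ`-th roots of unity sum to
zero) — "`Σ_{k=0}^{ℓ−1} p_{2k} = ℓ·(1,0,0)`". [cite: PrakashEtAl2017, Cor. 1 (p14)] -/
private theorem sum_cos_sum_sin_eq_zero {ℓ : ℕ} (hℓ : 2 ≤ ℓ) :
    (∑ j : Fin ℓ, Real.cos (2 * π * j / ℓ)) = 0 ∧ (∑ j : Fin ℓ, Real.sin (2 * π * j / ℓ)) = 0 := by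
  have hζ := Complex.isPrimitiveRoot_exp ℓ (by omega)
  have hsum := hζ.geom_sum_eq_zero (by omega)
  rw [Finset.sum_range] at hsum
  have hterm : ∀ j : Fin ℓ, Complex.exp (2 * π * Complex.I / ℓ) ^ (j : ℕ) =
      Complex.exp ((2 * π * j / ℓ : ℝ) * Complex.I) := by
    intro j
    rw [← Complex.exp_nat_mul]
    congr 1
    push_cast
    ring
  simp only [hterm] at hsum
  have hre := congrArg Complex.re hsum
  have him := congrArg Complex.im hsum
  rw [Complex.re_sum] at hre
  rw [Complex.im_sum] at him
  simp only [Complex.exp_ofReal_mul_I_re, Complex.zero_re, Complex.exp_ofReal_mul_I_im,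
    Complex.zero_im] at hre him
  exact ⟨hre, him⟩

/-- `cos(2π·(x mod n)/n) = cos(2πx/n)` and likewise for `sin` (`n ≥ 1`). [folklore] -/
private theorem cos_sin_mod (n x : ℕ) (hn : 0 < n) :
    Real.cos (2 * π * ((x % n : ℕ) : ℝ) / n) = Real.cos (2 * π * x / n) ∧
      Real.sin (2 * π * ((x % n : ℕ) : ℝ) / n) = Real.sin (2 * π * x / n) := by
  have hnR : (n : ℝ) ≠ 0 := by exact_mod_cast hn.ne'
  have hx : (x : ℝ) = (x % n : ℕ) + n * (x / n : ℕ) := by exact_mod_cast (Nat.mod_add_div x n).symm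
  have e : 2 * π * (x : ℝ) / n = 2 * π * ((x % n : ℕ) : ℝ) / n + (x / n : ℕ) * (2 * π) := by
    rw [hx]
    field_simp
  rw [e, Real.cos_add_nat_mul_two_pi, Real.sin_add_nat_mul_two_pi]
  exact ⟨rfl, rfl⟩

/-- The Lorentz-cone vectors `p_k = (1, cos(2πk/n), sin(2πk/n)) ∈ ℝ³` of Corollary 1.
[cite: PrakashEtAl2017, Cor. 1 (p14)] -/
def cyclicLorentzVec (n : ℕ) (k : Fin n) : EuclideanSpace ℝ (Fin 3) :=
  WithLp.toLp 2 ![1, Real.cos (2 * π * k / n), Real.sin (2 * π * k / n)]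

/-- `Gram({p_k}) = cyclicLorentzGram n`. [cite: PrakashEtAl2017, Cor. 1 (p14)] -/
theorem inner_cyclicLorentzVec (n : ℕ) (k k' : Fin n) :
    ⟪cyclicLorentzVec n k, cyclicLorentzVec n k'⟫ = cyclicLorentzGram n k k' := by
  rw [cyclicLorentzVec, cyclicLorentzVec, EuclideanSpace.inner_toLp_toLp, star_trivial]
  simp [dotProduct, Fin.sum_univ_three, cyclicLorentzGram]
  ring

/-- **Corollary 1 from Theorem 8** (p14–p15, verbatim): "Let `n = 2ℓ`, where `ℓ ≥ 3` is odd … Clearly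
`(p_k + p_{k+ℓ})/2 = (1,0,0)` and `⟨p_k, p_{k+ℓ}⟩ = 0` … `⟨p_k, p_{k'}⟩ ≥ 0` … `Σ_{k=0}^{ℓ−1} p_{2k} =
Σ_{k=0}^{ℓ−1} p_{2k+1} = ℓ·(1,0,0)`. Since `ℓ` is odd, it follows from Theorem 8 that `X := Gram({p_k})`
is not completely positive." Here: hypotheses (i)–(iv) of `PrakashEtAl2017_thm8` checked for
`F = {p_k}`, pairs `(p_k, p_{k+ℓ})` (`k ∈ ℤ_{2ℓ}`), `c = (1,0,0)`, `J = {2i : i < ℓ}`; conclusion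
`cyclicLorentzGram (2ℓ) ∈ DNN ∖ CP` (cf. the direct proof `PrakashEtAl2017_cor1_holds`).
[cite: PrakashEtAl2017, Cor. 1 (p14–p15), Thm. 8 (p14)] -/
theorem PrakashEtAl2017_cor1_of_thm8 {ℓ : ℕ} (hℓ : 3 ≤ ℓ) (hodd : Odd ℓ) :
    IsDnn (cyclicLorentzGram (2 * ℓ)) ∧ ¬ IsCp (cyclicLorentzGram (2 * ℓ)) := by
  classical
  have hn0 : 0 < 2 * ℓ := by omega
  have hℓ0 : 0 < ℓ := by omega
  have hnR : ((2 * ℓ : ℕ) : ℝ) ≠ 0 := by exact_mod_cast hn0.ne'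
  have hℓR : (ℓ : ℝ) ≠ 0 := by exact_mod_cast hℓ0.ne'
  set v : Fin (2 * ℓ) → EuclideanSpace ℝ (Fin 3) := cyclicLorentzVec (2 * ℓ) with hv
  have hG : (Matrix.of fun a b => ⟪v a, v b⟫) = cyclicLorentzGram (2 * ℓ) := by
    ext a b
    rw [of_apply, hv, inner_cyclicLorentzVec]
  rw [← hG]
  -- the pairing `k ↦ k + ℓ` and the angles
  set L : Fin (2 * ℓ) := ⟨ℓ, by omega⟩ with hL
  set θ : Fin (2 * ℓ) → ℝ := fun k => 2 * π * k / ((2 * ℓ : ℕ) : ℝ) with hθ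
  have hshift : ∀ k : Fin (2 * ℓ), Real.cos (θ (k + L)) = -Real.cos (θ k) ∧
      Real.sin (θ (k + L)) = -Real.sin (θ k) := by
    intro k
    have hval : ((k + L : Fin (2 * ℓ)) : ℕ) = ((k : ℕ) + ℓ) % (2 * ℓ) := by
      rw [Fin.val_add]
    have hc := cos_sin_mod (2 * ℓ) ((k : ℕ) + ℓ) hn0
    simp only [hθ, hval]
    rw [hc.1, hc.2]
    have e : 2 * π * (((k : ℕ) + ℓ : ℕ) : ℝ) / ((2 * ℓ : ℕ) : ℝ) = 2 * π * k / ((2 * ℓ : ℕ) : ℝ) + π := by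
      push_cast
      field_simp
    rw [e, Real.cos_add_pi, Real.sin_add_pi]
    exact ⟨rfl, rfl⟩
  have hvapply : ∀ k : Fin (2 * ℓ), v k = WithLp.toLp 2 ![1, Real.cos (θ k), Real.sin (θ k)] := fun k => rfl
  set c : EuclideanSpace ℝ (Fin 3) := WithLp.toLp 2 ![1, 0, 0] with hcdef
  have hc : c ≠ 0 := by
    intro h
    have := congrArg (fun x : EuclideanSpace ℝ (Fin 3) => (WithLp.ofLp x : Fin 3 → ℝ) 0) h
    simp [hcdef] at this
  -- the odd set `J = {2i : i < ℓ}`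
  let dbl : Fin ℓ ↪ Fin (2 * ℓ) := ⟨fun i => ⟨2 * i, by omega⟩, fun i j h => by
    have := congrArg Fin.val h
    exact Fin.ext (by simpa using this)⟩
  set J : Finset (Fin (2 * ℓ)) := Finset.univ.map dbl with hJdef
  have hJcard : J.card = ℓ := by simp [hJdef]
  refine PrakashEtAl2017_thm8 v id (fun k => k + L) c hc ?_ ?_ J (by rw [hJcard]; exact hodd) ?_ ?_
  · -- (i) `p_k + p_{k+ℓ} = 2c`
    intro k
    rw [id, hvapply, hvapply, (hshift k).1, (hshift k).2, hcdef, ← WithLp.toLp_add, ← WithLp.toLp_smul]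
    congr 1
    ext i
    fin_cases i <;> norm_num
  · -- (ii) `⟨p_k, p_{k+ℓ}⟩ = 0`
    intro k
    rw [id, hvapply, hvapply, (hshift k).1, (hshift k).2, EuclideanSpace.inner_toLp_toLp, star_trivial]
    simp [dotProduct, Fin.sum_univ_three]
    nlinarith [Real.cos_sq_add_sin_sq (θ k)]
  · -- (iii) `Σ_{i<ℓ} p_{2i} = ℓ c`
    rw [hJdef, Finset.sum_map, hJcard]
    have hang : ∀ i : Fin ℓ, θ (dbl i) = 2 * π * i / ℓ := by
      intro i
      simp only [hθ, dbl, Function.Embedding.coeFn_mk]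
      push_cast
      field_simp
    have h2 : 2 ≤ ℓ := by omega
    obtain ⟨hcos, hsin⟩ := sum_cos_sum_sin_eq_zero h2
    simp only [id, hvapply, hang, ← WithLp.toLp_sum, hcdef, ← WithLp.toLp_smul]
    congr 1
    ext i
    fin_cases i
    · simp
    · simp [Finset.sum_apply, hcos]
    · simp [Finset.sum_apply, hsin]
  · -- (iv) `⟨p_k, p_{k'}⟩ = 1 + cos(θ_k − θ_{k'}) ≥ 0`
    intro k k'
    rw [hvapply, hvapply, EuclideanSpace.inner_toLp_toLp, star_trivial]
    simp [dotProduct, Fin.sum_univ_three]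
    have h := Real.neg_one_le_cos (θ k - θ k')
    rw [Real.cos_sub] at h
    linarith

end Cor1

/-! ### Lemma 6: `GL^n` is convex iff `n ≤ 2` -/

section Lemma6

/-- The set of doubly nonnegative matrices is convex. [folklore] -/
private theorem convex_setOf_isDnn {ι : Type*} [Fintype ι] : Convex ℝ {X : Matrix ι ι ℝ | IsDnn X} := by
  intro X hX Y hY s t hs ht _
  refine ⟨?_, fun i j => ?_⟩
  · exact (hX.1.smul hs).add (hY.1.smul ht)
  · rw [Matrix.add_apply, Matrix.smul_apply, Matrix.smul_apply, smul_eq_mul, smul_eq_mul]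
    exact add_nonneg (mul_nonneg hs (hX.2 i j)) (mul_nonneg ht (hY.2 i j))

/-- A Gram–Lorentz matrix is doubly nonnegative (`GL ⊆ CS_+ ⊆ DNN`, Theorem 7 and p03).
[cite: PrakashEtAl2017, Lemma 6 proof (p14: "Since `GL² ⊆ DNN²`"), Thm. 7 (p14)] -/
theorem IsGramLorentz.isDnn {ι : Type*} [Fintype ι] {X : Matrix ι ι ℝ} (h : IsGramLorentz X) :
    IsDnn X :=
  h.isCpsd.isDnn
set_option maxHeartbeats 400000 in -- buildfix (bf3-g30): 160k/180k FAIL, 200k PASS at accept time; line-neutral budget line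
/-- **`GL² = DNN²`** (Lemma 6, Proof 7, p14, verbatim): "let `A := [[a, b],[b, c]] ∈ DNN²` … Note that
`ac ≥ b²` and wlog assume that `a ≥ c > 0`. Set `v₁ := √(a/2)(1,1,0)` and `v₂ := √(c/2)(1, d, √(1−d²))`,
where `d := (2b − √(ac))/√(ac)`. Lastly, note that `A = Gram({v₁, v₂})` and that `{v_i} ⊆ L_3`." Here
for `Fin 2`-indexed matrices; the degenerate case `ac = 0` (then `b = 0`) is done with
`v₁ = √(a/2)(1,1,0)`, `v₂ = √(c/2)(1,0,1)`. [cite: PrakashEtAl2017, Lemma 6 (p13–p14)] -/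
theorem isGramLorentz_iff_isDnn_two {X : Matrix (Fin 2) (Fin 2) ℝ} : IsGramLorentz X ↔ IsDnn X := by
  refine ⟨fun h => h.isDnn, fun h => ?_⟩
  obtain ⟨hpsd, hnn⟩ := h
  -- entries: `a = X 0 0`, `b = X 0 1 = X 1 0`, `c = X 1 1`; `a, b, c ≥ 0`, `b² ≤ ac`
  have hsymm : X 1 0 = X 0 1 := by
    have h := hpsd.1
    have := congrArg (fun M => M 0 1) h
    rw [conjTranspose_apply, star_trivial] at this
    exact this
  have ha : 0 ≤ X 0 0 := hnn 0 0
  have hb : 0 ≤ X 0 1 := hnn 0 1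
  have hc : 0 ≤ X 1 1 := hnn 1 1
  have hquad : ∀ w : Fin 2 → ℝ,
      0 ≤ w 0 * (X 0 0 * w 0 + X 0 1 * w 1) + w 1 * (X 0 1 * w 0 + X 1 1 * w 1) := by
    intro w
    have h1 := (Matrix.posSemidef_iff_dotProduct_mulVec.mp hpsd).2 w
    rw [star_trivial] at h1
    simpa [dotProduct, mulVec, Fin.sum_univ_two, hsymm] using h1
  have hdet : X 0 1 ^ 2 ≤ X 0 0 * X 1 1 := by
    have h1 := hquad ![X 1 1, -X 0 1]
    have h4 := hquad ![X 0 1, -(X 0 0 + 1)]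
    simp only [Matrix.cons_val_zero, Matrix.cons_val_one] at h1 h4
    rcases hc.lt_or_eq with hc' | hc'
    · nlinarith
    · rw [← hc'] at h1 h4 ⊢
      nlinarith
  set a := X 0 0 with ha_def
  set b := X 0 1 with hb_def
  set c := X 1 1 with hc_def
  set sa := Real.sqrt (a / 2) with hsa_def
  set sc := Real.sqrt (c / 2) with hsc_def
  have hsa0 : 0 ≤ sa := Real.sqrt_nonneg _
  have hsc0 : 0 ≤ sc := Real.sqrt_nonneg _
  have hsa : sa * sa = a / 2 := Real.mul_self_sqrt (by linarith)
  have hsc : sc * sc = c / 2 := Real.mul_self_sqrt (by linarith)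
  -- `X i j` by cases on `i, j`
  have hentry : ∀ (M : Matrix (Fin 2) (Fin 2) ℝ), M 0 0 = a → M 0 1 = b → M 1 0 = b → M 1 1 = c →
      ∀ i j, X i j = M i j := by
    intro M h00 h01 h10 h11 i j
    fin_cases i <;> fin_cases j
    · exact h00.symm
    · exact h01.symm
    · exact (hsymm.trans h10.symm)
    · exact h11.symm
  by_cases hac : a * c = 0
  · -- degenerate case: `b = 0`
    have hb0 : b = 0 := by
      have : b ^ 2 ≤ 0 := by rw [hac] at hdet; exact hdet
      nlinarith
    have hsasc : sa * sc = 0 := by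
      have h : (sa * sc) * (sa * sc) = 0 := by
        calc (sa * sc) * (sa * sc) = (sa * sa) * (sc * sc) := by ring
          _ = 0 := by rw [hsa, hsc, show a / 2 * (c / 2) = a * c / 4 by ring, hac, zero_div]
      exact eq_zero_of_mul_self_eq_zero h
    refine ⟨2, ![sa, sc], ![![sa, 0], ![0, sc]], fun i => ?_, ?_⟩
    · fin_cases i
      · simp [Fin.sum_univ_two, Real.sqrt_sq hsa0]
      · simp [Fin.sum_univ_two, Real.sqrt_sq hsc0]
    · refine hentry (Matrix.of fun i j => (![sa, sc] : Fin 2 → ℝ) i * (![sa, sc] : Fin 2 → ℝ) j +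
          ∑ l : Fin 2, (![![sa, 0], ![0, sc]] : Fin 2 → Fin 2 → ℝ) i l *
            (![![sa, 0], ![0, sc]] : Fin 2 → Fin 2 → ℝ) j l) ?_ ?_ ?_ ?_
      · simp [Fin.sum_univ_two]; linarith
      · simp [Fin.sum_univ_two]; rw [hb0, hsasc]
      · simp [Fin.sum_univ_two]; rw [hb0, mul_comm, hsasc]
      · simp [Fin.sum_univ_two]; linarith
  · -- generic case: the printed vectors
    have ha' : 0 < a := by
      rcases ha.lt_or_eq with h | h
      · exact h
      · exact absurd (by rw [← h, zero_mul]) hac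
    have hc' : 0 < c := by
      rcases hc.lt_or_eq with h | h
      · exact h
      · exact absurd (by rw [← h, mul_zero]) hac
    set r := Real.sqrt (a * c) with hr_def
    have hr : 0 < r := Real.sqrt_pos.mpr (mul_pos ha' hc')
    have hrr : r * r = a * c := Real.mul_self_sqrt (by positivity)
    set d := (2 * b - r) / r with hd
    -- `|d| ≤ 1`, i.e. `0 ≤ b ≤ √(ac)`
    have hbs : b ≤ r := by
      rw [hr_def, ← Real.sqrt_sq hb]
      exact Real.sqrt_le_sqrt hdet
    have hd' : d = 2 * b / r - 1 := by rw [hd]; field_simp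
    have hd1 : d ^ 2 ≤ 1 := by
      rw [hd']
      have h0 : 0 ≤ 2 * b / r := by positivity
      have h1 : 2 * b / r ≤ 2 := by
        rw [div_le_iff₀ hr]
        linarith
      nlinarith
    set sd := Real.sqrt (1 - d ^ 2) with hsd_def
    have hsd : sd * sd = 1 - d ^ 2 := Real.mul_self_sqrt (by linarith)
    have hsasc : sa * sc = r / 2 := by
      have h2 : (sa * sc) * (sa * sc) = (r / 2) * (r / 2) := by
        calc (sa * sc) * (sa * sc) = (sa * sa) * (sc * sc) := by ring
          _ = (r / 2) * (r / 2) := by rw [hsa, hsc]; linarith [hrr]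
      have h3 := mul_self_eq_mul_self_iff.mp h2
      rcases h3 with h3 | h3
      · exact h3
      · nlinarith [mul_nonneg hsa0 hsc0]
    -- the key identity `√(a/2)√(c/2)(1 + d) = b`
    have hkey : sa * sc * (1 + d) = b := by
      rw [hsasc, hd']
      field_simp
      ring
    refine ⟨2, ![sa, sc], ![![sa, 0], ![sc * d, sc * sd]], fun i => ?_, ?_⟩
    · have hds : d ^ 2 + sd ^ 2 = 1 := by nlinarith [hsd]
      have e : (sc * d) ^ 2 + (sc * sd) ^ 2 = sc ^ 2 := by
        rw [mul_pow, mul_pow, ← mul_add, hds, mul_one]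
      fin_cases i
      · simp [Fin.sum_univ_two, Real.sqrt_sq hsa0]
      · simp [Fin.sum_univ_two, e, Real.sqrt_sq hsc0]
    · refine hentry (Matrix.of fun i j => (![sa, sc] : Fin 2 → ℝ) i * (![sa, sc] : Fin 2 → ℝ) j +
          ∑ l : Fin 2, (![![sa, 0], ![sc * d, sc * sd]] : Fin 2 → Fin 2 → ℝ) i l *
            (![![sa, 0], ![sc * d, sc * sd]] : Fin 2 → Fin 2 → ℝ) j l) ?_ ?_ ?_ ?_
      · simp [Fin.sum_univ_two]; linarith
      · simp [Fin.sum_univ_two]; linear_combination hkey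
      · simp [Fin.sum_univ_two]; linear_combination hkey
      · simp [Fin.sum_univ_two]
        have e : sc * sd * (sc * sd) = sc * sc * (1 - d ^ 2) := by rw [← hsd]; ring
        nlinarith [e, hsc]

/-- **`GL^n = DNN^n` for `n ≤ 2`** (the `⇐` half of Lemma 6 rests on "`GL² = DNN²`"; for `n = 1` a
nonnegative scalar `a` is the Gram matrix of `(√a) ∈ L_1`, for `n = 0` there is nothing to show).
[cite: PrakashEtAl2017, Lemma 6 (p13–p14)] -/
theorem isGramLorentz_iff_isDnn_of_le_two {n : ℕ} (hn : n ≤ 2) {X : Matrix (Fin n) (Fin n) ℝ} :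
    IsGramLorentz X ↔ IsDnn X := by
  refine ⟨fun h => h.isDnn, fun h => ?_⟩
  rcases Nat.lt_or_ge n 2 with hn2 | hn2
  · rcases Nat.lt_or_ge n 1 with hn1 | hn1
    · have hn0 : n = 0 := by omega
      subst hn0
      exact ⟨0, fun _ => 0, fun _ => Fin.elim0, fun i => Fin.elim0 i, fun i => Fin.elim0 i⟩
    · have hn1' : n = 1 := by omega
      subst hn1'
      refine ⟨0, fun _ => Real.sqrt (X 0 0), fun _ => Fin.elim0, fun i => ?_, fun i j => ?_⟩
      · simp
      · fin_cases i; fin_cases j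
        simp [Real.mul_self_sqrt (h.2 0 0)]
  · have hn2' : n = 2 := by omega
    subst hn2'
    exact isGramLorentz_iff_isDnn_two.mpr h

/-- **`2I_n ∉ GL^n` for `n ≥ 3`** (Lemma 6, Proof 7, p14, verbatim): "suppose that `2I_n` is the Gram
matrix of the Lorentz vectors `{(t_i, u_i)}`. This implies that `t_i² + ‖u_i‖² = 2` for all `i` and
`t_i t_j + ⟨u_i, u_j⟩ = 0` for all `i ≠ j`. Since `t_i ≥ ‖u_i‖` …, the Cauchy–Schwarz inequality implies
that `t_i t_j ≥ ‖u_i‖‖u_j‖ ≥ |⟨u_i, u_j⟩| = t_i t_j` … equality holds throughout which shows that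
`t_i = ‖u_i‖ = 1` for all `i`, and that `u_i = −u_j` for all `i ≠ j`. This gives a contradiction since
`n ≥ 3`." [cite: PrakashEtAl2017, Lemma 6 (p13–p14)] -/
theorem two_smul_one_not_isGramLorentz {n : ℕ} (hn : 3 ≤ n) :
    ¬ IsGramLorentz ((2 : ℝ) • (1 : Matrix (Fin n) (Fin n) ℝ)) := by
  classical
  rintro ⟨k, t, x, hxt, hX⟩
  -- the Lorentz vectors `(t_i, u_i)`, `u_i ∈ ℝ^k`
  set u : Fin n → EuclideanSpace ℝ (Fin k) := fun i => WithLp.toLp 2 (x i) with hu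
  have hnorm : ∀ i, ‖u i‖ = Real.sqrt (∑ l, x i l ^ 2) := by
    intro i
    rw [EuclideanSpace.norm_eq]
    simp [hu]
  have hinner : ∀ i j, ⟪u i, u j⟫ = ∑ l, x i l * x j l := by
    intro i j
    rw [hu, EuclideanSpace.inner_toLp_toLp, star_trivial]
    simp only [dotProduct]
    exact Finset.sum_congr rfl fun l _ => mul_comm _ _
  have hut : ∀ i, ‖u i‖ ≤ t i := fun i => by rw [hnorm]; exact hxt i
  have hdiag : ∀ i, t i * t i + ‖u i‖ ^ 2 = 2 := by
    intro i
    have h := hX i i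
    rw [Matrix.smul_apply, Matrix.one_apply_eq, smul_eq_mul, mul_one, ← hinner,
      real_inner_self_eq_norm_sq] at h
    linarith
  have hoff : ∀ i j, i ≠ j → t i * t j + ⟪u i, u j⟫ = 0 := by
    intro i j hij
    have h := hX i j
    rw [Matrix.smul_apply, Matrix.one_apply_ne hij, smul_zero, ← hinner] at h
    linarith
  -- `t_j ≥ 1`
  have ht1 : ∀ i, 1 ≤ t i := by
    intro i
    have h0 : 0 ≤ t i := (norm_nonneg _).trans (hut i)
    have h1 : ‖u i‖ ^ 2 ≤ t i * t i := by nlinarith [hut i, norm_nonneg (u i)]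
    nlinarith [hdiag i]
  -- Cauchy–Schwarz: `‖u_i‖ = t_i` whenever some `j ≠ i` exists
  have hkey : ∀ i j, i ≠ j → ‖u i‖ = t i := by
    intro i j hij
    have h := hoff i j hij
    have h1 : t i * t j ≤ ‖u i‖ * ‖u j‖ := by
      have hcs := abs_real_inner_le_norm (u i) (u j)
      have := neg_le_abs ⟪u i, u j⟫
      linarith
    have h2 : ‖u i‖ * ‖u j‖ ≤ ‖u i‖ * t j := mul_le_mul_of_nonneg_left (hut j) (norm_nonneg _)
    have h3 : ‖u i‖ * t j ≤ t i * t j := mul_le_mul_of_nonneg_right (hut i) (by linarith [ht1 j])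
    have h4 : ‖u i‖ * t j = t i * t j := le_antisymm h3 (h1.trans h2)
    exact mul_right_cancel₀ (by linarith [ht1 j] : t j ≠ 0) h4
  set j0 : Fin n := ⟨0, by omega⟩ with hj0
  set j1 : Fin n := ⟨1, by omega⟩ with hj1
  set j2 : Fin n := ⟨2, by omega⟩ with hj2
  have h01 : j0 ≠ j1 := by simp [hj0, hj1]
  have h02 : j0 ≠ j2 := by simp [hj0, hj2]
  have h12 : j1 ≠ j2 := by simp [hj1, hj2]
  have ht_eq : ∀ i, t i = 1 ∧ ‖u i‖ = 1 := by
    intro i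
    obtain ⟨j, hij⟩ : ∃ j, i ≠ j := by
      by_cases h : i = j0
      · exact ⟨j1, by rw [h]; exact h01⟩
      · exact ⟨j0, h⟩
    have h1 := hkey i j hij
    have h2 := hdiag i
    rw [h1] at h2
    have ht0 : 0 ≤ t i := by linarith [ht1 i]
    have ht : t i = 1 := by nlinarith
    exact ⟨ht, by rw [h1, ht]⟩
  have hanti : ∀ i j, i ≠ j → u i + u j = 0 := by
    intro i j hij
    have h := hoff i j hij
    rw [(ht_eq i).1, (ht_eq j).1, one_mul] at h
    have hn2 : ‖u i + u j‖ ^ 2 = 0 := by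
      rw [norm_add_sq_real, (ht_eq i).2, (ht_eq j).2]
      linarith
    exact norm_eq_zero.mp (pow_eq_zero_iff two_ne_zero |>.mp hn2)
  -- `u_0 = −u_1 = u_2 = −u_0`
  have e1 := hanti j0 j1 h01
  have e2 := hanti j0 j2 h02
  have e3 := hanti j1 j2 h12
  have hu0 : u j0 = 0 := by
    have h2u : (2 : ℝ) • u j0 = 0 := by
      rw [two_smul]
      have : u j0 + u j0 = (u j0 + u j1) + (u j0 + u j2) - (u j1 + u j2) := by abel
      rw [this, e1, e2, e3]
      simp
    exact (smul_eq_zero.mp h2u).resolve_left two_ne_zero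
  have h := (ht_eq j0).2
  rw [hu0, norm_zero] at h
  exact zero_ne_one h

/-- `2n·e_ie_iᵀ ∈ GL^n`: the Gram matrix of the single Lorentz vector `(√n, √n) ∈ L_2` at position `i`
("Since `{e_ie_iᵀ} ⊆ GL^n` we have that `2I_n` is in the convex hull of `GL^n`", p14).
[cite: PrakashEtAl2017, Lemma 6 (p14)] -/
theorem isGramLorentz_single_diag {n : ℕ} (i : Fin n) :
    IsGramLorentz ((2 * n : ℝ) • Matrix.single i i (1 : ℝ)) := by
  classical
  refine ⟨1, fun j => if j = i then Real.sqrt n else 0, fun j _ => if j = i then Real.sqrt n else 0,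
    fun j => ?_, fun j j' => ?_⟩
  · by_cases hj : j = i
    · simp only [hj, if_true, Finset.univ_unique, Fin.default_eq_zero, Finset.sum_singleton]
      rw [Real.sqrt_sq (Real.sqrt_nonneg _)]
    · simp [hj]
  · rw [Matrix.smul_apply, Matrix.single_apply, smul_eq_mul, Fin.sum_univ_one]
    dsimp only
    have hs : Real.sqrt n * Real.sqrt n = n := Real.mul_self_sqrt (Nat.cast_nonneg n)
    by_cases hj : j = i
    · subst hj
      by_cases hj' : j' = j
      · subst hj'
        rw [if_pos ⟨rfl, rfl⟩, if_pos rfl]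
        linarith
      · rw [if_neg (fun h => hj' h.2.symm), if_pos rfl, if_neg hj']
        ring
    · rw [if_neg (fun h => hj h.1.symm), if_neg hj]
      ring

/-- `2I_n = (1/n) Σ_i 2n·e_ie_iᵀ` lies in the convex hull of `GL^n` (`n ≥ 1`). [cite: PrakashEtAl2017, Lemma 6 (p14)] -/
theorem two_smul_one_mem_convexHull_isGramLorentz {n : ℕ} (hn : 1 ≤ n) :
    (2 : ℝ) • (1 : Matrix (Fin n) (Fin n) ℝ) ∈
      convexHull ℝ {X : Matrix (Fin n) (Fin n) ℝ | IsGramLorentz X} := by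
  classical
  have hnR : (n : ℝ) ≠ 0 := by exact_mod_cast (show n ≠ 0 by omega)
  have hrepr : (2 : ℝ) • (1 : Matrix (Fin n) (Fin n) ℝ) =
      ∑ i : Fin n, (n : ℝ)⁻¹ • ((2 * n : ℝ) • Matrix.single i i (1 : ℝ)) := by
    ext a b
    rw [Matrix.sum_apply, Matrix.smul_apply, Matrix.one_apply, smul_eq_mul]
    simp only [Matrix.smul_apply, Matrix.single_apply, smul_eq_mul, mul_ite, mul_one, mul_zero]
    by_cases hab : a = b
    · subst hab
      rw [if_pos rfl]
      have e : ∀ x : Fin n, (x = a ∧ x = a) = (x = a) := fun x => by rw [and_self]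
      simp only [e, Finset.sum_ite_eq' Finset.univ a, Finset.mem_univ, if_true]
      field_simp
    · rw [if_neg hab]
      refine (Finset.sum_eq_zero fun x _ => ?_).symm
      rw [if_neg]
      rintro ⟨h1, h2⟩
      exact hab (h1.symm.trans h2)
  rw [hrepr]
  refine (convex_convexHull ℝ _).sum_mem (fun i _ => by positivity) ?_ fun i _ =>
    subset_convexHull ℝ _ (isGramLorentz_single_diag i)
  rw [Finset.sum_const, Finset.card_univ, Fintype.card_fin, nsmul_eq_mul, mul_inv_cancel₀ hnR]

/-- **PSVW Lemma 6** (p13, verbatim): "The set `GL^n` is convex if and only if `n ≤ 2`." (`⇐`: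
`GL^n = DNN^n` for `n ≤ 2`, and `DNN^n` is convex; `⇒`: for `n ≥ 3`, `2I_n ∈ conv(GL^n) ∖ GL^n`.)
[cite: PrakashEtAl2017, Lemma 6 (p13–p14)] -/
theorem convex_setOf_isGramLorentz_iff {n : ℕ} :
    Convex ℝ {X : Matrix (Fin n) (Fin n) ℝ | IsGramLorentz X} ↔ n ≤ 2 := by
  constructor
  · intro hconv
    by_contra hn
    push Not at hn
    have hmem := two_smul_one_mem_convexHull_isGramLorentz (n := n) (by omega)
    rw [hconv.convexHull_eq] at hmem
    exact two_smul_one_not_isGramLorentz (by omega) hmem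
  · intro hn
    have hset : {X : Matrix (Fin n) (Fin n) ℝ | IsGramLorentz X} = {X | IsDnn X} := by
      ext X
      exact isGramLorentz_iff_isDnn_of_le_two hn
    rw [hset]
    exact convex_setOf_isDnn

end Lemma6

/-! ### Lemma 7: a `GL`-factorization in `L_{rank X + 2}` (appended) -/

section Lemma7

variable {ι : Type*} [Fintype ι]

/-- Rank is subadditive (copy of the private helper of `CompletelyPsdRank.lean`). [folklore] -/
private theorem rank_add_le'' {m n : Type*} [Fintype m] [Fintype n] [DecidableEq n]
    (A B : Matrix m n ℝ) : (A + B).rank ≤ A.rank + B.rank := by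
  unfold Matrix.rank
  rw [Matrix.mulVecLin_add]
  calc Module.finrank ℝ (LinearMap.range (A.mulVecLin + B.mulVecLin))
      ≤ Module.finrank ℝ ↥(LinearMap.range A.mulVecLin ⊔ LinearMap.range B.mulVecLin) :=
        Submodule.finrank_mono (LinearMap.range_add_le _ _)
    _ ≤ _ := Submodule.finrank_add_le_finrank_add_finrank _ _

/-- Padding coordinates by zeros does not change sums (copy of the private helper of
`CompletelyPsdRank.lean`). [folklore] -/
private theorem sum_dite_castLE' {s n : ℕ} (hsn : s ≤ n) (f : Fin s → ℝ) :
    ∑ l : Fin n, (if h : (l : ℕ) < s then f ⟨l, h⟩ else 0) = ∑ l : Fin s, f l := by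
  classical
  let emb : Fin s ↪ Fin n := ⟨Fin.castLE hsn, Fin.castLE_injective hsn⟩
  symm
  rw [← Finset.sum_map univ emb (fun l : Fin n => if h : (l : ℕ) < s then f ⟨l, h⟩ else 0)
    |>.trans (Finset.sum_congr rfl fun l _ => by
      have hl : ((emb l : Fin n) : ℕ) < s := by simp [emb]
      rw [dif_pos hl]
      exact congrArg f (Fin.ext rfl))]
  refine Finset.sum_subset (subset_univ _) fun l _ hl => ?_
  have hl' : ¬ (l : ℕ) < s := fun hlt =>
    hl (Finset.mem_map.mpr ⟨⟨l, hlt⟩, mem_univ _, Fin.ext rfl⟩)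
  rw [dif_neg hl']

/-- **PSVW Lemma 7** (p14, verbatim): "Any `X ∈ GL^n` has a `GL`-factorization using vectors in
`L_{rank(X)+2}`." Typed in the tree's `L_{k+1} = {(c, y) ∈ ℝ × ℝ^k : ‖y‖ ≤ c}` convention with
`k = rank X + 1`: Lorentz vectors `(c_i, y_i)`, `y_i ∈ ℝ^{rank X + 1}`, `‖y_i‖ ≤ c_i`, with
`X_{ij} = c_ic_j + ⟨y_i, y_j⟩`. PROVED as printed (Proof 8): "`X = U + ttᵀ`. Since `U` is psd of rank at
most `r := rank(X)+1`, there exists a family of vectors `{ũ_i} ⊆ ℝ^r` such that `U = Gram({ũ_i})` …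
`‖ũ_i‖ = ‖u_i‖` … the vectors `ℓ̃_i := (t_i, ũ_i)` lie in `L_{r+1}`" (Gram vectors of `U` in `ℝ^{rank U}`,
`rank U ≤ rank X + rank(ttᵀ) ≤ rank X + 1`, padded by zeros). [cite: PrakashEtAl2017, Lemma 7 (p14)] -/
theorem PrakashEtAl2017_lemma7 {X : Matrix ι ι ℝ} (h : IsGramLorentz X) :
    ∃ (c : ι → ℝ) (y : ι → Fin (X.rank + 1) → ℝ), (∀ i, Real.sqrt (∑ l, y i l ^ 2) ≤ c i) ∧
      ∀ i j, X i j = c i * c j + ∑ l, y i l * y j l := by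
  classical
  obtain ⟨k, c, x, hxc, hX⟩ := h
  -- `U = Gram(x_i) = M Mᵀ`, psd, `X = ccᵀ + U`
  let M : Matrix ι (Fin k) ℝ := Matrix.of fun i l => x i l
  have hUapply : ∀ i j, (M * Mᵀ) i j = ∑ l, x i l * x j l := fun i j => by
    simp only [Matrix.mul_apply, Matrix.transpose_apply, M, Matrix.of_apply]
  have hU : (M * Mᵀ).PosSemidef := by
    simpa [conjTranspose_eq_transpose_of_trivial] using posSemidef_self_mul_conjTranspose M
  have hUX : M * Mᵀ = X + vecMulVec (-c) c := by
    ext i j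
    rw [hUapply, Matrix.add_apply, vecMulVec_apply, Pi.neg_apply, hX i j]
    ring
  -- `rank U ≤ rank X + 1`
  have hrank : (M * Mᵀ).rank ≤ X.rank + 1 := by
    rw [hUX]
    calc (X + vecMulVec (-c) c).rank ≤ X.rank + (vecMulVec (-c) c).rank := rank_add_le'' _ _
      _ ≤ X.rank + 1 := Nat.add_le_add_left (rank_vecMulVec_le (-c) c) _
  -- Gram vectors of `U` in `ℝ^{rank U}`, padded to `ℝ^{rank X + 1}`
  obtain ⟨xt, hxt⟩ := exists_gram_vectors_fin_rank hU
  let y : ι → Fin (X.rank + 1) → ℝ := fun i l =>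
    if h : (l : ℕ) < (M * Mᵀ).rank then xt i ⟨l, h⟩ else 0
  have hyy : ∀ i j, ∑ l, y i l * y j l = ∑ l, x i l * x j l := by
    intro i j
    rw [← hUapply i j, hxt i j, ← sum_dite_castLE' hrank (fun l => xt i l * xt j l)]
    refine Finset.sum_congr rfl fun l _ => ?_
    by_cases h : (l : ℕ) < (M * Mᵀ).rank
    · simp only [y, dif_pos h]
    · simp only [y, dif_neg h, mul_zero]
  refine ⟨c, y, fun i => ?_, fun i j => ?_⟩
  · have h2 : ∑ l, y i l ^ 2 = ∑ l, x i l ^ 2 := by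
      simp only [sq]
      exact hyy i i
    rw [h2]
    exact hxc i
  · rw [hX i j, hyy]

/-- Hence `X ∈ GL^n` iff `X` is the Gram matrix of Lorentz vectors of `L_{rank X + 2}` (the dimension in
Definition 3's "for some `m ≥ 1`" can be taken to be `rank X + 2`). [cite: PrakashEtAl2017, Lemma 7 (p14)] -/
theorem isGramLorentz_iff_rank {X : Matrix ι ι ℝ} :
    IsGramLorentz X ↔ ∃ (c : ι → ℝ) (y : ι → Fin (X.rank + 1) → ℝ),
      (∀ i, Real.sqrt (∑ l, y i l ^ 2) ≤ c i) ∧ ∀ i j, X i j = c i * c j + ∑ l, y i l * y j l :=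
  ⟨PrakashEtAl2017_lemma7, fun ⟨c, y, hyc, hX⟩ => ⟨X.rank + 1, c, y, hyc, hX⟩⟩

end Lemma7

end Literature.Combinatorics.Optimization
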